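import Summits.HodgeConjecture.CorCM.Census.TwistGenerationCover

/-!
# Uniform twist generation, V: THE RESIDUAL ELIMINATION — a Hodge vector on the residual types lies in ℤ⟨pairs⟩ + ℤ⟨transfers, upper stars⟩

COR-CM (cell `pub-hodgecm2`), count-neutral kernel combinatorics by the binder seat b09 (gen 36; lane UNIFORM TWIST GENERATION, part V), on
parts I–IV (`cst`, `catom`, `trans`, `wplus`, `resVec`, `pot`, the residual types) used BY NAME.  Theorems only: no definition, no `decide`, no
certificate, no named fact, no `sorry`.
HONEST FRAMING: `HC_CM` is NOT proved, here or anywhere in the tree; nothing here is a period or a headline.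

Along a datum `θ : G ≃ ℤ/2n × B`, with a base column `b₀`:
* §1 type sums of centres and canonical atoms (`typeSum_single_cst`, `typeSum_single_catom`), conjugates (`rt_self_catom`), the half-sum splitting of
  `ℤ/2n` (`sum_eq_sum_half`) and the window identity (`ite_sub_ite_eq`); `−n = n` is used inline (it is
  `GaloisSemidihedral.neg_natCast_h` of `CorCM/GaloisSemidihedralModularNormalForms.lean`, not imported into this census chain);
* §2 **pure residual combinations** (`sum_resVec_mem_span_pairSet`): a combination of centres and canonical atoms off `b₀` with CONSTANT type sum is a
  sum of pairs — reading the type sum at `θ⁻¹(z, b₀)` against `θ⁻¹(z, b)` forces the atom coefficients to be `n`-periodic in `z`, and reading it at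
  `θ⁻¹(z, b₀)` against `θ⁻¹(z − 1, b₀)` forces the centre coefficients to be `n`-periodic;
* §3 **THE RESIDUAL ELIMINATION** (`residual_mem`): if `L` (with `ℤ⟨pairs⟩ ≤ L ≤ hodgeSpan`) holds the transfers `trans a x b` of the interior places
  (`1 ≤ (x − a).val < n`) and the upper stars `wplus x`, then every Hodge vector supported on types of potential `≤ 1` lies in `L` — every atom is a
  canonical atom plus centres modulo a chain of transfers (`single_oflipCM_cst_sub_mem`), the canonical atoms of the base column are the others plus
  centres modulo an upper star, and §2 finishes.

## References
* [Pohlmann1968] H. Pohlmann, Algebraic cycles on abelian varieties of complex multiplication type, Ann. of Math. 88 (1968), Thm 1.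
* [Milne1999] J. S. Milne, Lefschetz motives and the Tate conjecture, Compositio Math. 117 (1999), Prop. 2.1, p. 54.
-/

namespace Summit.HodgeConjecture.CorCM.Census.TwistGeneration

open Finset
open Summit.HodgeConjecture.CorCM.Prior.AllgGroup.RfwfAllgGroup
open Summit.HodgeConjecture.CorCM.Census.BlockParity
open Summit.HodgeConjecture.CorCM.Census.Coinvariant

noncomputable section

variable {G : Type*} [Group G] [Fintype G] [DecidableEq G] {c : G}
variable {B : Type} [AddGroup B] [DecidableEq B]
variable {n : ℕ} [NeZero n] (θ : G ≃ ZMod (2 * n) × B)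
variable (hθ : ∀ P Q : G, θ (P * Q) = θ P + θ Q) (hθc : θ c = (((n : ℕ) : ZMod (2 * n)), 0))

/-! ## §1 Type sums of the residual vocabulary -/

omit [DecidableEq B] in
/-- **Type sum of a centre**: `typeSum [cst a] P = [(θP).1 ∈ arc a]`. [folklore] -/
theorem typeSum_single_cst (a : ZMod (2 * n)) (P : G) :
    typeSum G c (Finsupp.single (cst θ hθ hθc a) 1) P = if ((θ P).1 - a).val < n then 1 else 0 := by
  rw [typeSum_single]; unfold indG
  by_cases h : ((θ P).1 - a).val < n
  · rw [if_pos ((mem_cst θ hθ hθc a P).mpr h), if_pos h]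
  · rw [if_neg (fun h' => h ((mem_cst θ hθ hθc a P).mp h')), if_neg h]

omit [AddGroup B] [DecidableEq B] in
/-- `(x, b) ≠ (x + n, b)` in `ℤ/2n × B`. [folklore] -/
theorem mk_ne_mk_add_n (x : ZMod (2 * n)) (b : B) : ((x, b) : ZMod (2 * n) × B) ≠ (x + n, b) := by
  intro h
  have h1 : ((n : ℕ) : ZMod (2 * n)) = 0 := by
    have := (Prod.ext_iff.mp h).1
    linear_combination -this
  have h2 := congrArg ZMod.val h1
  rw [val_n, ZMod.val_zero] at h2
  exact NeZero.ne n h2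

/-- **Type sum of a canonical atom**: `typeSum [catom x b] P = [(θP).1 ∈ arc x] − [θP = (x, b)] + [θP = (x + n, b)]`. [folklore] -/
theorem typeSum_single_catom (hc2 : c * c = 1) (x : ZMod (2 * n)) (b : B) (P : G) :
    typeSum G c (Finsupp.single (catom θ hθ hθc hc2 x b) 1) P =
      (if ((θ P).1 - x).val < n then 1 else 0) - (if θ P = (x, b) then 1 else 0) + (if θ P = (x + n, b) then 1 else 0) := by
  rw [typeSum_single, ← typeSum_single_cst θ hθ hθc x P, typeSum_single]
  change indG (oflip c (θ.symm (x, b)) (cst θ hθ hθc x).1) P = _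
  have hnn := mk_ne_mk_add_n (n := n) x b
  by_cases hP : P ∈ orb c (θ.symm (x, b))
  · rw [indG_oflip_of_mem c hP]
    rw [mem_orb, c_mul_symm θ hθ hθc] at hP
    rcases hP with rfl | rfl
    · have h1 : indG (cst θ hθ hθc x).1 (θ.symm (x, b)) = 1 := by
        unfold indG; rw [if_pos (symm_self_mem_cst θ hθ hθc x b)]
      rw [h1, Equiv.apply_symm_apply, if_pos rfl, if_neg hnn]; ring
    · have h0 : indG (cst θ hθ hθc x).1 (θ.symm (x + n, b)) = 0 := by
        unfold indG
        rw [if_neg (by rw [symm_mem_cst, add_sub_cancel_left, val_n]; exact lt_irrefl n)]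
      rw [h0, Equiv.apply_symm_apply, if_neg (Ne.symm hnn), if_pos rfl]; ring
  · rw [indG_oflip_of_not_mem c hP]
    rw [mem_orb, c_mul_symm θ hθ hθc, not_or] at hP
    have h1 : θ P ≠ (x, b) := fun h => hP.1 (by rw [← h, Equiv.symm_apply_apply])
    have h2 : θ P ≠ (x + n, b) := fun h => hP.2 (by rw [← h, Equiv.symm_apply_apply])
    rw [if_neg h1, if_neg h2]; ring

omit [DecidableEq B] in
/-- **The conjugate of a canonical atom** is the canonical atom of the antipodal place: `(catom x b)·c = catom (x + n) b`. [folklore] -/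
theorem rt_self_catom (hc2 : c * c = 1) (x : ZMod (2 * n)) (b : B) :
    rt c c (catom θ hθ hθc hc2 x b) = catom θ hθ hθc hc2 (x + n) b := by
  unfold catom
  rw [rt_oflipCM, rt_self_cst, inv_eq_of_mul_eq_one_right hc2, mul_comm_c θ hθ hθc, c_mul_symm θ hθ hθc]

omit [DecidableEq B] in
/-- The pair of a centre: `[cst a] + [cst (a + n)] ∈ pairSet`. [folklore] -/
theorem single_cst_add_mem_span_pairSet (a : ZMod (2 * n)) :
    Finsupp.single (cst θ hθ hθc a) 1 + Finsupp.single (cst θ hθ hθc (a + n)) 1 ∈ Submodule.span ℤ (pairSet c) := by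
  rw [← rt_self_cst θ hθ hθc]
  exact Submodule.subset_span (pair_mem_pairSet c _)

omit [DecidableEq B] in
/-- The pair of a canonical atom: `[catom x b] + [catom (x + n) b] ∈ pairSet`. [folklore] -/
theorem single_catom_add_mem_span_pairSet (hc2 : c * c = 1) (x : ZMod (2 * n)) (b : B) :
    Finsupp.single (catom θ hθ hθc hc2 x b) 1 + Finsupp.single (catom θ hθ hθc hc2 (x + n) b) 1 ∈ Submodule.span ℤ (pairSet c) := by
  rw [← rt_self_catom θ hθ hθc]
  exact Submodule.subset_span (pair_mem_pairSet c _)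

/-- **Half-sum splitting of `ℤ/2n`**: `Σ_x f x = Σ_{x.val < n} (f x + f (x + n))`. [folklore] -/
theorem sum_eq_sum_half {M : Type*} [AddCommMonoid M] (f : ZMod (2 * n) → M) :
    ∑ x, f x = ∑ x ∈ univ.filter (fun x : ZMod (2 * n) => x.val < n), (f x + f (x + n)) := by
  rw [sum_add_distrib, ← sum_filter_add_sum_filter_not univ (fun x : ZMod (2 * n) => x.val < n) f]
  congr 1
  have himg : univ.filter (fun x : ZMod (2 * n) => ¬ x.val < n) =
      (univ.filter (fun x : ZMod (2 * n) => x.val < n)).image (fun x : ZMod (2 * n) => x + n) := by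
    ext y
    simp only [mem_filter, mem_univ, true_and, mem_image]
    constructor
    · intro hy
      refine ⟨y + n, ?_, by rw [add_assoc, n_add_n, add_zero]⟩
      by_contra h
      exact hy (by rw [lt_iff_not_lt_add_n]; exact h)
    · rintro ⟨x, hx, rfl⟩
      exact (lt_iff_not_lt_add_n x).mp hx
  rw [himg, sum_image fun x _ x' _ h => by simpa using h]

/-- **The window identity**: `[v ∈ arc 0] − [v − 1 ∈ arc 0] = [v = 0] − [v = n]` (as integers). [folklore] -/
theorem ite_sub_ite_eq (v : ZMod (2 * n)) :
    ((if v.val < n then (1 : ℤ) else 0) - (if (v - 1).val < n then 1 else 0)) =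
      (if v = 0 then 1 else 0) - (if v = (n : ℕ) then 1 else 0) := by
  have hn : 1 ≤ n := Nat.one_le_iff_ne_zero.mpr (NeZero.ne n)
  have h1 : (1 : ZMod (2 * n)).val = 1 := by
    rw [show (1 : ZMod (2 * n)) = ((1 : ℕ) : ZMod (2 * n)) by norm_cast, ZMod.val_natCast, Nat.mod_eq_of_lt (by omega)]
  have hv := ZMod.val_lt v
  have hsub : (v - 1).val = if 1 ≤ v.val then v.val - 1 else v.val + 2 * n - 1 := by rw [val_sub_eq, h1]
  have h0 : v = 0 ↔ v.val = 0 := by rw [← ZMod.val_eq_zero]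
  have hvn : v = (n : ℕ) ↔ v.val = n := by
    constructor
    · rintro rfl; exact val_n
    · intro h; apply ZMod.val_injective; rw [h, val_n]
  simp only [h0, hvn, hsub]
  split_ifs <;> omega

omit [NeZero n] in
/-- `z − a = n ↔ a = z + n` in `ℤ/2n`. [folklore] -/
theorem sub_eq_n_iff (z a : ZMod (2 * n)) : z - a = (n : ℕ) ↔ a = z + n := by
  -- `−n = n` in `ℤ/2n` (cf. `GaloisSemidihedral.neg_natCast_h`, not imported here)
  have hneg : -((n : ℕ) : ZMod (2 * n)) = n := by rw [neg_eq_iff_add_eq_zero, n_add_n]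
  constructor
  · intro h; rw [← sub_sub_cancel z a, h, sub_eq_add_neg, hneg]
  · intro h; rw [h, sub_add_cancel_left, hneg]

omit [AddGroup B] in
/-- The correction sum of the canonical atoms at a point `(z, b)`: one term, in the column `b ≠ b₀`. [folklore] -/
theorem sum_corr_eq {b₀ : B} [Fintype B] (ν : ZMod (2 * n) × {b : B // b ≠ b₀} → ℤ) (z w : ZMod (2 * n)) (b : B) :
    ∑ i, ν i * (if ((z, b) : ZMod (2 * n) × B) = (i.1 + w, i.2.1) then (1 : ℤ) else 0) =
      if h : b ≠ b₀ then ν (z - w, ⟨b, h⟩) else 0 := by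
  split_ifs with hb
  · rw [Finset.sum_eq_single (z - w, ⟨b, hb⟩)]
    · simp only [sub_add_cancel, if_true, mul_one]
    · intro i _ hi
      rw [if_neg, mul_zero]
      intro h
      apply hi
      obtain ⟨h1, h2⟩ := Prod.ext_iff.mp h
      simp only at h1 h2
      exact Prod.ext (by rw [h1, add_sub_cancel_right]) (Subtype.ext h2.symm)
    · intro h; exact absurd (mem_univ _) h
  · refine Finset.sum_eq_zero fun i _ => ?_
    rw [if_neg, mul_zero]
    intro h
    obtain ⟨-, h2⟩ := Prod.ext_iff.mp h
    simp only at h2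
    exact i.2.2 (by rw [← h2]; exact not_not.mp hb)

/-! ## §2 Pure residual combinations with constant type sum are sums of pairs -/

section Pure

variable [Fintype B]

omit [DecidableEq B] [Fintype B] in
/-- **Centre combinations.**  If `Σ_a μ_a [cst a]` has constant type sum then `μ` is `n`-periodic and the combination is a sum of pairs. [folklore] -/
theorem sum_cst_mem_span_pairSet (b₀ : B) (μ : ZMod (2 * n) → ℤ)
    (hk : ∃ k : ℤ, ∀ P : G, typeSum G c (∑ a, μ a • Finsupp.single (cst θ hθ hθc a) 1) P = k) :
    ∑ a, μ a • Finsupp.single (cst θ hθ hθc a) 1 ∈ Submodule.span ℤ (pairSet c) := by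
  obtain ⟨k, hk⟩ := hk
  -- the type sum at `θ⁻¹(z, b₀)` is the window sum `Σ_a μ_a [z ∈ arc a]`
  have hval : ∀ z : ZMod (2 * n), typeSum G c (∑ a, μ a • Finsupp.single (cst θ hθ hθc a) 1) (θ.symm (z, b₀)) =
      ∑ a, μ a * (if (z - a).val < n then 1 else 0) := by
    intro z
    rw [map_sum, Finset.sum_apply]
    refine sum_congr rfl fun a _ => ?_
    rw [map_smul, Pi.smul_apply, smul_eq_mul, typeSum_single_cst, Equiv.apply_symm_apply]
  -- periodicity: `μ z = μ (z + n)`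
  have hper : ∀ z : ZMod (2 * n), μ z = μ (z + n) := by
    intro z
    have h := hk (θ.symm (z, b₀))
    rw [← hk (θ.symm (z - 1, b₀)), hval, hval, ← sub_eq_zero, ← sum_sub_distrib] at h
    have e : ∀ a : ZMod (2 * n), μ a * (if (z - a).val < n then (1 : ℤ) else 0) - μ a * (if (z - 1 - a).val < n then 1 else 0) =
        μ a * (if z = a then 1 else 0) - μ a * (if a = z + n then 1 else 0) := by
      intro a
      rw [← mul_sub, ← mul_sub, show z - 1 - a = z - a - 1 by ring, ite_sub_ite_eq]
      simp only [sub_eq_zero, sub_eq_n_iff]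
    simp only [e] at h
    simp only [sum_sub_distrib, mul_boole, Finset.sum_ite_eq, Finset.sum_ite_eq', mem_univ, if_true] at h
    linear_combination h
  rw [sum_eq_sum_half]
  refine Submodule.sum_mem _ fun a _ => ?_
  rw [← hper a, ← smul_add]
  exact Submodule.smul_mem _ _ (single_cst_add_mem_span_pairSet θ hθ hθc a)

/-- **Pure residual combinations.**  A combination of the residual family `resVec b₀` (centres, canonical atoms off the base column `b₀`) with
constant type sum is a sum of pairs. [folklore] -/
theorem sum_resVec_mem_span_pairSet (hc2 : c * c = 1) (b₀ : B) (f : ZMod (2 * n) ⊕ (ZMod (2 * n) × {b : B // b ≠ b₀}) → ℤ)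
    (hk : ∃ k : ℤ, ∀ P : G, typeSum G c (∑ i, f i • resVec θ hθ hθc hc2 b₀ i) P = k) :
    ∑ i, f i • resVec θ hθ hθc hc2 b₀ i ∈ Submodule.span ℤ (pairSet c) := by
  obtain ⟨k, hk⟩ := hk
  set μ : ZMod (2 * n) → ℤ := fun a => f (Sum.inl a) with hμ
  set ν : ZMod (2 * n) × {b : B // b ≠ b₀} → ℤ := fun i => f (Sum.inr i) with hν
  have hsplit : ∑ i, f i • resVec θ hθ hθc hc2 b₀ i =
      (∑ a, μ a • Finsupp.single (cst θ hθ hθc a) 1) + ∑ i, ν i • Finsupp.single (catom θ hθ hθc hc2 i.1 i.2.1) 1 := by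
    rw [Fintype.sum_sum_type]; rfl
  -- type sums at `θ⁻¹(z, b)`: window sums plus the correction terms of the column `b`
  have hval : ∀ (z : ZMod (2 * n)) (b : B), typeSum G c (∑ i, f i • resVec θ hθ hθc hc2 b₀ i) (θ.symm (z, b)) =
      (∑ a, μ a * (if (z - a).val < n then (1 : ℤ) else 0)) + ((∑ i, ν i * (if (z - i.1).val < n then (1 : ℤ) else 0))
        - (∑ i, ν i * (if ((z, b) : ZMod (2 * n) × B) = (i.1 + 0, i.2.1) then (1 : ℤ) else 0))
        + ∑ i, ν i * (if ((z, b) : ZMod (2 * n) × B) = (i.1 + n, i.2.1) then (1 : ℤ) else 0)) := by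
    intro z b
    rw [hsplit, map_add, Pi.add_apply, map_sum, map_sum, Finset.sum_apply, Finset.sum_apply, ← sum_sub_distrib, ← sum_add_distrib]
    congr 1
    · refine sum_congr rfl fun a _ => ?_
      rw [map_smul, Pi.smul_apply, smul_eq_mul, typeSum_single_cst, Equiv.apply_symm_apply]
    · refine sum_congr rfl fun i _ => ?_
      rw [map_smul, Pi.smul_apply, smul_eq_mul, typeSum_single_catom, Equiv.apply_symm_apply, add_zero, mul_add, mul_sub]
  -- periodicity of the atom coefficients: compare the columns `b₀` and `β`
  have hν : ∀ (z : ZMod (2 * n)) (β : {b : B // b ≠ b₀}), ν (z, β) = ν (z + n, β) := by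
    intro z β
    have h := hk (θ.symm (z, b₀))
    rw [← hk (θ.symm (z, β.1)), hval, hval, sum_corr_eq, sum_corr_eq, sum_corr_eq, sum_corr_eq, dif_neg (not_not.mpr rfl),
      dif_neg (not_not.mpr rfl), dif_pos β.2, dif_pos β.2, sub_zero, sub_eq_add_neg z (n : ZMod (2 * n)),
      show -((n : ℕ) : ZMod (2 * n)) = n by rw [neg_eq_iff_add_eq_zero, n_add_n]] at h
    have e : (⟨β.1, β.2⟩ : {b : B // b ≠ b₀}) = β := Subtype.ext rfl
    rw [e, sub_zero] at h
    linear_combination h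
  -- the atom part is a sum of pairs
  have hatom : ∑ i, ν i • Finsupp.single (catom θ hθ hθc hc2 i.1 i.2.1) 1 ∈ Submodule.span ℤ (pairSet c) := by
    rw [Fintype.sum_prod_type, sum_comm]
    refine Submodule.sum_mem _ fun β _ => ?_
    rw [sum_eq_sum_half]
    refine Submodule.sum_mem _ fun x _ => ?_
    rw [← hν x β, ← smul_add]
    exact Submodule.smul_mem _ _ (single_catom_add_mem_span_pairSet θ hθ hθc hc2 x β.1)
  -- the centre part has constant type sum, hence is a sum of pairs
  have hcen := mul_comm_c θ hθ hθc
  obtain ⟨k', hk'⟩ := exists_forall_typeSum_eq_of_mem_span_pairSet c hcen hatom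
  have hcst : ∑ a, μ a • Finsupp.single (cst θ hθ hθc a) 1 ∈ Submodule.span ℤ (pairSet c) := by
    refine sum_cst_mem_span_pairSet θ hθ hθc b₀ μ ⟨k - k', fun P => ?_⟩
    have h := hk P
    rw [hsplit, map_add, Pi.add_apply, hk' P] at h
    linear_combination h
  rw [hsplit]
  exact Submodule.add_mem _ hcst hatom

end Pure

/-! ## §3 The residual elimination -/

section Elim

variable [Fintype B]

omit [DecidableEq B] [Fintype B] in
/-- **Atoms are canonical atoms plus centres modulo transfers**: if `L` holds the interior transfers, then for `(x − a).val < n`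
`[cst a^{(θ⁻¹(x,b))}] − [cst a] − ([catom x b] − [cst x]) ∈ L`. [folklore] -/
theorem single_oflipCM_cst_sub_mem (hc2 : c * c = 1) (L : Submodule ℤ (CMF G c →₀ ℤ))
    (hT : ∀ (a x : ZMod (2 * n)) (b : B), 1 ≤ (x - a).val → (x - a).val < n → trans θ hθ hθc hc2 a x b ∈ L) :
    ∀ (k : ℕ) (a x : ZMod (2 * n)) (b : B), (x - a).val = k → k < n →
      Finsupp.single (oflipCM c hc2 (θ.symm (x, b)) (cst θ hθ hθc a)) 1 - Finsupp.single (cst θ hθ hθc a) 1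
        - (Finsupp.single (catom θ hθ hθc hc2 x b) 1 - Finsupp.single (cst θ hθ hθc x) 1) ∈ L := by
  intro k
  induction k with
  | zero =>
    intro a x b h0 _
    have hxa : x = a := by rwa [ZMod.val_eq_zero, sub_eq_zero] at h0
    subst hxa
    rw [catom, sub_self]
    exact Submodule.zero_mem _
  | succ k ih =>
    intro a x b hk hkn
    have h1 : (1 : ZMod (2 * n)).val = 1 := by
      rw [show (1 : ZMod (2 * n)) = ((1 : ℕ) : ZMod (2 * n)) by norm_cast, ZMod.val_natCast,
        Nat.mod_eq_of_lt (by have := NeZero.ne n; omega)]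
    have hk' : (x - (a + 1)).val = k := by
      rw [show x - (a + 1) = x - a - 1 by ring, ZMod.val_sub (by rw [h1]; omega), h1, hk]; rfl
    have e : Finsupp.single (oflipCM c hc2 (θ.symm (x, b)) (cst θ hθ hθc a)) 1 - Finsupp.single (cst θ hθ hθc a) 1
        - (Finsupp.single (catom θ hθ hθc hc2 x b) 1 - Finsupp.single (cst θ hθ hθc x) 1) =
        trans θ hθ hθc hc2 a x b + (Finsupp.single (oflipCM c hc2 (θ.symm (x, b)) (cst θ hθ hθc (a + 1))) 1
          - Finsupp.single (cst θ hθ hθc (a + 1)) 1 - (Finsupp.single (catom θ hθ hθc hc2 x b) 1 - Finsupp.single (cst θ hθ hθc x) 1)) := by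
      rw [trans]; abel
    rw [e]
    exact Submodule.add_mem _ (hT a x b (by omega) (by omega)) (ih (a + 1) x b hk' (by omega))

/-- **THE RESIDUAL ELIMINATION.**  Let `ℤ⟨pairs⟩ ≤ L ≤ hodgeSpan` hold the interior transfers and the upper stars.  Then every Hodge vector
supported on the residual types (potential `≤ 1`) lies in `L`. [folklore] -/
theorem residual_mem (hc2 : c * c = 1) (b₀ : B) (L : Submodule ℤ (CMF G c →₀ ℤ))
    (hP : Submodule.span ℤ (pairSet c) ≤ L) (hLH : L ≤ hodgeSpan c hc2)
    (hT : ∀ (a x : ZMod (2 * n)) (b : B), 1 ≤ (x - a).val → (x - a).val < n → trans θ hθ hθc hc2 a x b ∈ L)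
    (hW : ∀ x : ZMod (2 * n), wplus θ hθ hθc hc2 x ∈ L)
    (y : CMF G c →₀ ℤ) (hy : ∃ k : ℤ, ∀ P : G, typeSum G c y P = k) (hsupp : ∀ Ψ ∈ y.support, pot θ hθ hθc Ψ ≤ 1) : y ∈ L := by
  classical
  have hcen := mul_comm_c θ hθ hθc
  set V : Submodule ℤ (CMF G c →₀ ℤ) := Submodule.span ℤ (Set.range (resVec θ hθ hθc hc2 b₀)) with hV
  -- every residual type lies in `V + L`
  have hres : ∀ Ψ : CMF G c, pot θ hθ hθc Ψ ≤ 1 → Finsupp.single Ψ 1 ∈ V ⊔ L := by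
    intro Ψ hΨ
    obtain ⟨a, h⟩ := eq_cst_or_eq_oflipCM_of_pot_le_one θ hθ hθc hc2 hΨ
    rcases h with rfl | ⟨t, ht, rfl⟩
    · exact Submodule.mem_sup_left (Submodule.subset_span ⟨Sum.inl a, rfl⟩)
    · -- write `t = θ⁻¹(x, b)` with `(x − a).val < n`
      obtain ⟨⟨x, b⟩, rfl⟩ := θ.symm.surjective t
      rw [symm_mem_cst] at ht
      have hchain := single_oflipCM_cst_sub_mem θ hθ hθc hc2 L hT _ a x b rfl ht
      have hcst : ∀ a' : ZMod (2 * n), Finsupp.single (cst θ hθ hθc a') 1 ∈ V ⊔ L :=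
        fun a' => Submodule.mem_sup_left (Submodule.subset_span ⟨Sum.inl a', rfl⟩)
      have hoff : ∀ b' : B, b' ≠ b₀ → Finsupp.single (catom θ hθ hθc hc2 x b') 1 ∈ V ⊔ L :=
        fun b' hb' => Submodule.mem_sup_left (Submodule.subset_span ⟨Sum.inr (x, ⟨b', hb'⟩), rfl⟩)
      have hcat : Finsupp.single (catom θ hθ hθc hc2 x b) 1 ∈ V ⊔ L := by
        by_cases hb : b = b₀
        · -- the base column: use the upper star
          subst hb
          have hw := hW x
          rw [wplus, ← Finset.add_sum_erase _ _ (mem_univ b)] at hw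
          have e : Finsupp.single (catom θ hθ hθc hc2 x b) 1 = wplus θ hθ hθc hc2 x
              - (∑ b' ∈ univ.erase b, Finsupp.single (catom θ hθ hθc hc2 x b') 1)
              + ((Fintype.card B : ℤ) - 1) • Finsupp.single (cst θ hθ hθc x) 1 + Finsupp.single (cst θ hθ hθc (x + 1)) 1 := by
            rw [wplus, ← Finset.add_sum_erase _ _ (mem_univ b)]; abel
          rw [e]
          refine Submodule.add_mem _ (Submodule.add_mem _ (Submodule.sub_mem _ (Submodule.mem_sup_right (hW x))
            (Submodule.sum_mem _ fun b' hb' => hoff b' (mem_erase.mp hb').1)) (Submodule.smul_mem _ _ (hcst x))) (hcst _)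
        · exact hoff b hb
      have e : (Finsupp.single (oflipCM c hc2 (θ.symm (x, b)) (cst θ hθ hθc a)) (1 : ℤ) : CMF G c →₀ ℤ) =
          (Finsupp.single (oflipCM c hc2 (θ.symm (x, b)) (cst θ hθ hθc a)) 1 - Finsupp.single (cst θ hθ hθc a) 1
            - (Finsupp.single (catom θ hθ hθc hc2 x b) 1 - Finsupp.single (cst θ hθ hθc x) 1))
          + Finsupp.single (cst θ hθ hθc a) 1 + Finsupp.single (catom θ hθ hθc hc2 x b) 1 - Finsupp.single (cst θ hθ hθc x) 1 := by abel
      rw [e]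
      exact Submodule.sub_mem _ (Submodule.add_mem _ (Submodule.add_mem _ (Submodule.mem_sup_right hchain) (hcst a)) hcat) (hcst x)
  -- `y ∈ V + L`; split `y = v + ℓ`
  have hyVL : y ∈ V ⊔ L := by
    rw [← Finsupp.sum_single y]
    exact Submodule.sum_mem _ fun Ψ hΨ => by
      rw [← mul_one (y Ψ), ← smul_eq_mul, ← Finsupp.smul_single]
      exact Submodule.smul_mem _ _ (hres Ψ (hsupp Ψ hΨ))
  obtain ⟨v, hv, ℓ, hℓ, hvl⟩ := Submodule.mem_sup.mp hyVL
  -- the `V`-part has constant type sum, hence is a sum of pairs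
  obtain ⟨f, hf⟩ := (Submodule.mem_span_range_iff_exists_fun ℤ).mp hv
  obtain ⟨k, hk⟩ := hy
  obtain ⟨k', hk'⟩ := exists_forall_typeSum_eq_of_mem_hodgeSpan c hc2 hcen (hLH hℓ)
  have hvk : ∃ k'' : ℤ, ∀ P : G, typeSum G c (∑ i, f i • resVec θ hθ hθc hc2 b₀ i) P = k'' := by
    refine ⟨k - k', fun P => ?_⟩
    have h := hk P
    rw [← hvl, map_add, Pi.add_apply, hk' P] at h
    rw [hf]
    linear_combination h
  have hvP := sum_resVec_mem_span_pairSet θ hθ hθc hc2 b₀ f hvk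
  rw [hf] at hvP
  rw [← hvl]
  exact Submodule.add_mem _ (hP hvP) hℓ

end Elim

end

end Summit.HodgeConjecture.CorCM.Census.TwistGeneration
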